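import Literature.NumberTheory.Automorphic.GodementJacquetRankOneEntire
import Literature.NumberTheory.Automorphic.SatakeParameterBoundHolds
import Literature.NumberTheory.Automorphic.PairLFunctionPolesRepDataHolds
import Literature.NumberTheory.Automorphic.PairLFunctionPolesRankNeGodementJacquet
import Literature.NumberTheory.Automorphic.PairLFunctionPolesGLOneBoundaryUnconditional
import HarnessLib

/-!
# Godement–Jacquet in rank `n ≥ 2`: finite boundary values of `L^S(s, Π)` on `Re s = 1`

Topic `NumberTheory/Automorphic`; namespace `Literature.NumberTheory.Automorphic`. Proof file (theorems
only: no definition, no named fact, no instance), sibling of `GodementJacquetRankOneEntire` and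
`GodementJacquetZetaIntegralsProofs`, under the named facts `GodementJacquet1972_gjZeta_meromorphic`
(Godement–Jacquet, *Zeta functions of simple algebras*, LNM 260 (1972), Thm. 13.8: `L(s, Π)` is entire for
cuspidal `Π` on `GL_n`, `n ≥ 2`) and `JacquetShalika1981_partialPairL_boundary_repData`
(`PairLFunctionPolesRepData`; Arthur–Clozel (1989), Ch. 3 §2 (2.2), p. 171, at `GL_n × GL_1`). Of the
latter, the FINITENESS half at `GL_n × GL_1`, `n ≥ 2`, is proved here from theorems of the tree; the
non-vanishing half (Jacquet–Shalika, Invent. Math. 38 (1976)) is not touched.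

* `exists_entire_eq_mul_partialStandardL_of_two_le` — **the zeta quotient at a point in rank `n ≥ 2`**:
  for `Π ≤ L²_cusp(GL_n)`, `T = T(𝔫)`, a `K`-finite `K^T`-fixed `0 ≠ φ ∈ Π` and unfolding data adapted
  to a complex point (`exists_unfolding_data_at`), `Z(s) = A(s) L^T(s, Π)` on a right half-plane with
  `Z`, `A` ENTIRE and `A ≠ 0` at the point — `Z` is the entire continuation of the global zeta integral
  (`GodementJacquet1972_gjZeta_meromorphic_holds`), the factorisation is the `K^T`-spherical unfolding
  `gjZeta_awayProductMeasure_eq`, and `A = vol(K^T) · Z_T` with `Re Z_T > 0` at the point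
  (`re_placesZeta_pos_at`); the rank-one model is `exists_entire_eq_mul_partialStandardL_fin_one`;
* `exists_tendsto_partialStandardL_of_two_le` — hence **`L^S(s, Π)` has a finite limit at every `s₀`
  from inside `Re s > 1`**, for every finite `S` containing the primes of a level of `Π` (identity
  theorem on the half-plane, where `L^S` is holomorphic by Jacquet–Shalika's (5.3.3),
  `differentiableOn_partialStandardL_of_summable`, then `L^S = Z / A` near `s₀`);
* `exists_tendsto_partialStandardL_bj` — the same for cuspidal **Borel–Jacquet data** with unitary Satake
  families at the points of `Re s = 1` (unitary normalisation `t_{π,w} = q_w^{s} t_{Π,w}`, `Re s = 0`,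
  through the discharged dictionary leaves, exactly as in `JacquetShalika1981_partialPairL_pole_repData_rank`);
* `exists_tendsto_partialPairL_singleton_one` — `L^S(s, ε)` is finite at `s = 1` for a finite-order Hecke
  character `ε ≠ 1` (Hecke–Landau, `exists_ne_zero_tendsto_partialHeckeL_of_re_eq_one`), in the pair
  spelling `L^S(s, {ε(ϖ_w)} × {1})`;
* `satakePairPolynomial_map_mul_singleton_one` — `det(1 - (e t) ⊗ {1} T) = det(1 - t ⊗ {e} T)`.

The first consumer is the dihedral case of the adjoint lift `GL₂ → GL₃` (`adjoint_dihedral_core` of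
`SelfdualGL3AdjointLiftProofs`, whose hypotheses (2.2) at `GL₃ × GL₁` and `GL₁ × GL₁` it discharges in
their finite part).

## References

* R. Godement, H. Jacquet, *Zeta functions of simple algebras*, LNM 260 (1972), §§12–13, Thm. 13.8
  [GodementJacquet1972].
* J. Arthur, L. Clozel, *Simple algebras, base change, and the advanced theory of the trace formula*,
  Ann. of Math. Stud. 120 (1989), Ch. 3 §2, (2.1)–(2.3), p. 171 [ArthurClozelAMS120].
* H. Jacquet, J. A. Shalika, *On Euler products and the classification of automorphic representations
  I*, Amer. J. Math. 103 (1981), Thm. (5.3) [JacquetShalikaAJM1981].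
* K. Iwasawa, *Hecke's `L`-functions* (Princeton lectures 1964), SpringerBriefs (2019), Prop. 4.4
  [Iwasawa2019].
-/

noncomputable section

open MeasureTheory Measure Set Filter Topology IsDedekindDomain NumberField NumberField.mixedEmbedding
open scoped ENNReal NNReal ComplexConjugate MatrixGroups InnerProductSpace Classical

namespace Literature.NumberTheory.Automorphic

open Literature.NumberTheory.GaloisRepresentations (HeckeCharacter)

-- the quotient carries the tree's Borel σ-algebra, not Mathlib's quotient σ-algebra
attribute [-instance] Quotient.instMeasurableSpace QuotientGroup.measurableSpace

/-! ### Godement–Jacquet in rank `n ≥ 2`: the zeta quotient at a point -/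

section ZetaQuotient

variable {n : ℕ} {K : Type} [Field K] [NumberField K]
  {μ : Measure (AdelicGroupData.gl n K).automorphicQuotient} [(AdelicGroupData.gl n K).IsAutomorphicMeasure μ]

attribute [local instance] adelicBorel borelSpace_adelic locallyCompactSpace_adelic
  secondCountableTopology_gl_adelic measurableSpaceQuotient borelSpaceQuotient glBorel borelSpace_glBorel
  isHaarMeasure_glForm smulInvariantMeasureQuotient isFiniteMeasureOnCompactsQuotient
  secondCountableTopology_adeleRing locallyCompactSpace_adeleRing'

/-- **The zeta quotient of `L^T(s, Π)` at a prescribed point, rank `n ≥ 2`.** For `Π` cuspidal in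
`L²(GL_n)`, `T = T(𝔫)`, a non-zero `K`-finite `K^T`-fixed `φ ∈ Π`, an honest Satake family `γ` of `Π`
off `T` and unfolding data adapted to the point `s₀ + (n-1)/2` (`exists_unfolding_data_at`), there are
ENTIRE `Z`, `A` with `A(s₀) ≠ 0` and `Z(s) = A(s) L^T(s, γ)` on a right half-plane: `Z(s)` is the entire
continuation of the zeta integral `Z(Φ_∞ ⊗ 1_{B(𝔫)}, s + (n-1)/2, φ, φ)`
(`GodementJacquet1972_gjZeta_meromorphic_holds`), the factorisation is the `K^T`-spherical unfolding
`gjZeta_awayProductMeasure_eq`, and `A = vol(K^T) Z_T(· + (n-1)/2)` with `Re Z_T > 0` at the point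
(`re_placesZeta_pos_at`). The rank-one model is `exists_entire_eq_mul_partialStandardL_fin_one`.
[cite: GodementJacquet1972, Thm. 13.8 (proof)] -/
theorem exists_entire_eq_mul_partialStandardL_of_two_le (hn : 2 ≤ n) (P : CuspidalAutomorphicRepGL n K μ)
    {𝔫 : Ideal (𝓞 K)} (h𝔫 : 𝔫 ≠ 0) {γ : SatakeFamily K}
    (hγ : IsSatakeFamilyOf P (↑(primesOf h𝔫) : Set (HeightOneSpectrum (𝓞 K))) γ)
    {φ : (AdelicGroupData.gl n K).L2 μ} (hφP : φ ∈ P.1) (hφ0 : φ ≠ 0) (hφK : IsKFiniteVector μ φ)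
    (hφT : ∀ k ∈ awayLevel K n (primesOf h𝔫), (AdelicGroupData.gl n K).rightRegular μ k φ = φ)
    {Φinf : SchwartzMap (Fin n → Fin n → mixedSpace K) ℂ}
    (hΦ01 : ∀ x, ∃ r : ℝ, 0 ≤ r ∧ r ≤ 1 ∧ Φinf x = r)
    (hΦ1 : Φinf (1 : Matrix (Fin n) (Fin n) (mixedSpace K)) = 1)
    {N : Set (GL (Fin n) (AdeleRing (𝓞 K) K))} (hN : IsCompact N) (s₀ : ℂ)
    (hsupp : ∀ a : placesFactor K n (primesOf h𝔫),
      gjTestFunctionG n K Φinf 𝔫 (a : GL (Fin n) (AdeleRing (𝓞 K) K)) ≠ 0 →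
        (a : GL (Fin n) (AdeleRing (𝓞 K) K)) ∈ N ∧
          ‖glMatrixCoeff μ φ φ (a : GL (Fin n) (AdeleRing (𝓞 K) K)) *
              ((adelicAbsDet n K (a : GL (Fin n) (AdeleRing (𝓞 K) K)) : ℝ) : ℂ) ^
                (s₀ + ((n : ℂ) - 1) / 2) - ⟪φ, φ⟫_ℂ‖ < ‖φ‖ ^ 2 / 2) :
    ∃ (Z A : ℂ → ℂ) (x₀ : ℝ), Differentiable ℂ Z ∧ Differentiable ℂ A ∧ A s₀ ≠ 0 ∧
      ∀ s : ℂ, x₀ < s.re →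
        Z s = A s * partialStandardL (↑(primesOf h𝔫) : Set (HeightOneSpectrum (𝓞 K))) γ s := by
  set T : Finset (HeightOneSpectrum (𝓞 K)) := primesOf h𝔫 with hTdef
  haveI : LocallyCompactSpace (GL (Fin n) (AdeleRing (𝓞 K) K)) :=
    AdelicGroupData.locallyCompactSpace_gl_adelic_holds n K
  haveI : SecondCountableTopology (GL (Fin n) (AdeleRing (𝓞 K) K)) :=
    secondCountableTopology_generalLinearGroup_adeleRing K (Fin n)
  -- the test function and its `G_T`-part
  set Φ := gjTestFunction n K Φinf 𝔫 with hΦdef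
  set Ψ : GL (Fin n) (AdeleRing (𝓞 K) K) → ℂ := gjTestFunctionG n K Φinf 𝔫 with hΨdef
  have hΨc : Continuous Ψ := continuous_gjTestFunctionG Φinf h𝔫
  have hΨN : ∀ a : placesFactor K n T, Ψ a ≠ 0 → (a : GL (Fin n) (AdeleRing (𝓞 K) K)) ∈ N :=
    fun a ha => (hsupp a ha).1
  -- Haar measures on the factors and the product Haar measure on `GL_n(𝔸_K)`
  letI : MeasurableSpace (awayFactor K n T) := borel _
  haveI : BorelSpace (awayFactor K n T) := ⟨rfl⟩
  letI : MeasurableSpace (placesFactor K n T) := borel _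
  haveI : BorelSpace (placesFactor K n T) := ⟨rfl⟩
  haveI := locallyCompactSpace_awayFactor K n T
  haveI := locallyCompactSpace_placesFactor K n T
  set μH : Measure (awayFactor K n T) := Measure.haar with hμH
  set μG : Measure (placesFactor K n T) := Measure.haar with hμG
  set m : Measure (GL (Fin n) (AdeleRing (𝓞 K) K)) := awayProductMeasure K n T μH μG with hm
  haveI hmH : m.IsHaarMeasure := isHaarMeasure_awayProductMeasure μH μG
  -- `Z`: the entire continuation of the zeta integral for `m` (Godement–Jacquet, `n ≥ 2`)
  obtain ⟨x₁, -, g, -, hgd, hgeq⟩ := GodementJacquet1972_gjZeta_meromorphic_holds P Φ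
    (gjTestFunction_mem Φinf h𝔫) φ φ hφP hφP hφK hφK m
  have hZ : Differentiable ℂ g := hgd hn
  -- `A = vol(K^T) · Z_T(· + (n-1)/2)`
  have hvol0 : 0 < (μH (awayLevelIn K n T)).toReal :=
    ENNReal.toReal_pos ((isOpen_awayLevelIn K n T).measure_pos μH ⟨1, one_mem _⟩).ne'
      (measure_awayLevelIn_lt_top μH).ne
  set A : ℂ → ℂ := fun s => ((μH (awayLevelIn K n T)).toReal : ℂ) *
    placesZeta T μG Ψ φ (s + ((n : ℂ) - 1) / 2) with hA
  have hAd : Differentiable ℂ A :=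
    ((differentiable_placesZeta μG hΨc hN hΨN φ).comp
      (differentiable_id.add (differentiable_const _))).const_mul _
  have hA0 : A s₀ ≠ 0 := by
    refine mul_ne_zero (Complex.ofReal_ne_zero.2 hvol0.ne') fun h => ?_
    have hpos := re_placesZeta_pos_at μG hΨc (exists_gjTestFunctionG_eq hΦ01 𝔫)
      (gjTestFunctionG_one hΦ1 𝔫) hN hφ0 (s₀ + ((n : ℂ) - 1) / 2) hsupp
    rw [h, Complex.zero_re] at hpos
    exact lt_irrefl _ hpos
  refine ⟨fun s => g (s + ((n : ℂ) - 1) / 2), A, max x₁ ((n : ℝ) * n + n + 2),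
    hZ.comp (differentiable_id.add (differentiable_const _)), hAd, hA0, fun s hs => ?_⟩
  -- the unfolding identity on the half-plane
  set s' : ℂ := s + ((n : ℂ) - 1) / 2 with hs'def
  have hre : s'.re = s.re + ((n : ℝ) - 1) / 2 := re_add_half_sub_one s
  have hn1 : (1 : ℝ) ≤ n := by exact_mod_cast (show 1 ≤ n by omega)
  have hs' : (n : ℝ) * n + n + 2 ≤ s'.re := by
    rw [hre]; nlinarith [le_max_right x₁ ((n : ℝ) * n + n + 2)]
  have hx₁ : x₁ < s'.re := by
    rw [hre]; nlinarith [le_max_left x₁ ((n : ℝ) * n + n + 2)]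
  have hcard : ∀ v : HeightOneSpectrum (𝓞 K), v ∉ T → Multiset.card (γ v) = n :=
    fun v hv => hγ.card_eq fun h => hv (Finset.mem_coe.1 h)
  have hmain := gjZeta_awayProductMeasure_eq μH μG P hγ hφP hφ0 hφT φ hs' Φ
    (fun a : placesFactor K n T => Ψ (a : GL (Fin n) (AdeleRing (𝓞 K) K)))
    (fun h a => gjTestFunction_mul Φinf h𝔫 h a) (continuous_gjTestFunction Φinf h𝔫)
    (integrable_norm_mul_adelicAbsDet_rpow μG hΨc hN hΨN s'.re)
  have hbridge : ∀ i : {w : HeightOneSpectrum (𝓞 K) // w ∉ T}, localEulerInv n (γ i.1) i.1 s' =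
      ((eulerPolynomial (γ i.1)).eval ((i.1.residueCard : ℂ) ^ (-s)))⁻¹ := fun i =>
    localEulerInv_eq_inv_eval (hcard i.1 i.2) i.1 s
  have hmult : Multipliable fun i : {w : HeightOneSpectrum (𝓞 K) // w ∉ T} =>
      ((eulerPolynomial (γ i.1)).eval ((i.1.residueCard : ℂ) ^ (-s)))⁻¹ :=
    ((hasSum_unfoldTerm_intCosetsAway P hγ hφP hφ0 hφT φ hs').1).congr hbridge
  have hsplit := partialStandardL_eq_prod_mul_tprod (Finset.Subset.refl T) γ s hmult
  rw [Finset.sdiff_self, Finset.prod_empty, one_mul] at hsplit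
  have htprod : (∏' i : {w : HeightOneSpectrum (𝓞 K) // w ∉ T}, localEulerInv n (γ i.1) i.1 s') =
      partialStandardL (↑T : Set (HeightOneSpectrum (𝓞 K))) γ s := by
    rw [hsplit]
    exact tprod_congr hbridge
  show g s' = A s * partialStandardL (↑T : Set (HeightOneSpectrum (𝓞 K))) γ s
  rw [hgeq s' hx₁]
  change gjZeta μ m Φ φ φ s' = A s * partialStandardL (↑T : Set (HeightOneSpectrum (𝓞 K))) γ s
  rw [hm, hmain.2, htprod, hA]
  simp only [placesZeta]
  ring

/-- **Boundary values of `L^S(s, Π)` for cuspidal `Π` on `GL_n`, `n ≥ 2` (Godement–Jacquet).** For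
`Π` cuspidal in `L²(GL_n(F) A_G \ GL_n(𝔸_F))` there is a finite `S₀` (the primes of a level of a
non-zero `K`-finite vector of `Π`) such that for every finite `S ⊇ S₀`, every honest Satake family `γ`
of `Π` off `S` and EVERY `s₀ ∈ ℂ`, `L^S(s, γ)` has a finite limit as `s → s₀` inside `Re s > 1`: with
the zeta quotient `Z = A L^S`, `A(s₀) ≠ 0`, of `exists_entire_eq_mul_partialStandardL_of_two_le`
(data adapted to `s₀`), `Z = A L^S` on all of `Re s > 1` by the identity theorem (`L^S` is
holomorphic there, `differentiableOn_partialStandardL_of_summable` with Jacquet–Shalika's (5.3.3)),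
so `L^S = Z / A → Z(s₀)/A(s₀)`. (Godement–Jacquet, LNM 260, Thm. 13.8: `L(s, Π)` is entire; only
this consequence is recorded.) [cite: GodementJacquet1972, Thm. 13.8] -/
theorem exists_tendsto_partialStandardL_of_two_le (hn : 2 ≤ n) (P : CuspidalAutomorphicRepGL n K μ) :
    ∃ S₀ : Finset (HeightOneSpectrum (𝓞 K)), ∀ (S : Finset (HeightOneSpectrum (𝓞 K))), S₀ ⊆ S →
      ∀ {γ : SatakeFamily K}, IsSatakeFamilyOf P (↑S : Set (HeightOneSpectrum (𝓞 K))) γ →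
        ∀ s₀ : ℂ, ∃ c : ℂ, Tendsto (partialStandardL (↑S : Set (HeightOneSpectrum (𝓞 K))) γ)
          (𝓝[{s : ℂ | 1 < s.re}] s₀) (𝓝 c) := by
  -- a non-zero `K`-finite vector of finite level
  obtain ⟨𝔫₀, φ, h𝔫₀, hφP, hφ0, hφfix, hφK⟩ := exists_isKFiniteVector_principalCongruenceLevel
    exists_fixedVectors_principalCongruenceLevel_ne_bot_holds
    (principalCongruenceLevel_mem_finiteLevelsGL_holds n K) P
  refine ⟨primesOf h𝔫₀, fun S hS₀ γ hγ s₀ => ?_⟩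
  have hT : ∀ w : HeightOneSpectrum (𝓞 K), w.asIdeal ∣ 𝔫₀ → w ∈ S := fun w hw =>
    hS₀ ((mem_primesOf_iff h𝔫₀).2 hw)
  have hfix : ∀ v ∉ S, ∀ x ∈ valuedCongruenceSubgroup (Fin n) (1 : WithZero (Multiplicative ℤ)),
      (AdelicGroupData.gl n K).rightRegular μ (GLn.ofLocal n K v x) φ = φ := fun v hv x hx =>
    hφfix _ (awayLevel_le_principalCongruenceLevel h𝔫₀ hT (ofLocal_mem_awayLevel_of_mem hv hx))
  obtain ⟨𝔫, h𝔫, Φinf, N, hTS, hΦ01, hΦ1, hN, hsupp⟩ :=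
    exists_unfolding_data_at S hφ0 hfix (s₀ + ((n : ℂ) - 1) / 2)
  subst hTS
  have hφT : ∀ k ∈ awayLevel K n (primesOf h𝔫), (AdelicGroupData.gl n K).rightRegular μ k φ = φ :=
    fun k hk => hφfix k (awayLevel_le_principalCongruenceLevel h𝔫₀ hT hk)
  obtain ⟨Z, A, x₀, hZ, hA, hA0, hZA⟩ := exists_entire_eq_mul_partialStandardL_of_two_le hn P h𝔫 hγ
    hφP hφ0 hφK hφT hΦ01 hΦ1 hN s₀ hsupp
  -- `Z = A L^S` on `Re s > 1` by the identity theorem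
  set U : Set ℂ := {z : ℂ | 1 < z.re} with hU
  set L := partialStandardL (↑(primesOf h𝔫) : Set (HeightOneSpectrum (𝓞 K))) γ with hL
  have hUo : IsOpen U := isOpen_lt continuous_const Complex.continuous_re
  have hUc : IsPreconnected U := (convex_halfSpace_re_gt (1 : ℝ)).isPreconnected
  have hLU : AnalyticOnNhd ℂ L U :=
    (differentiableOn_partialStandardL_of_summable summable_normSq_trace_satakePow_holds P hγ).analyticOnNhd
      hUo
  have hALU : AnalyticOnNhd ℂ (fun s => A s * L s) U := (hA.differentiableOn.analyticOnNhd hUo).mul hLU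
  have hZU : AnalyticOnNhd ℂ Z U := hZ.differentiableOn.analyticOnNhd hUo
  set x : ℝ := max x₀ 1 + 1 with hx
  have hxU : ((x : ℝ) : ℂ) ∈ U := by
    show 1 < ((x : ℝ) : ℂ).re
    rw [Complex.ofReal_re, hx]
    linarith [le_max_right x₀ 1]
  have hV : {s : ℂ | max x₀ 1 < s.re} ∈ 𝓝 ((x : ℝ) : ℂ) :=
    (isOpen_lt continuous_const Complex.continuous_re).mem_nhds (by
      show max x₀ 1 < ((x : ℝ) : ℂ).re
      rw [Complex.ofReal_re, hx]
      linarith)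
  have hev : Z =ᶠ[𝓝 ((x : ℝ) : ℂ)] fun s => A s * L s := by
    filter_upwards [hV] with s hs using hZA s (lt_of_le_of_lt (le_max_left _ _) hs)
  have heq : EqOn Z (fun s => A s * L s) U := hZU.eqOn_of_preconnected_of_eventuallyEq hALU hUc hxU hev
  -- the limit `Z(s₀) / A(s₀)`
  refine ⟨Z s₀ / A s₀, ?_⟩
  have hcont : Tendsto (fun s => Z s / A s) (𝓝[U] s₀) (𝓝 (Z s₀ / A s₀)) :=
    (((hZ s₀).continuousAt.div (hA s₀).continuousAt hA0).tendsto).mono_left nhdsWithin_le_nhds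
  refine hcont.congr' ?_
  have hne : ∀ᶠ s in 𝓝[U] s₀, A s ≠ 0 :=
    ((hA s₀).continuousAt.eventually_ne hA0).filter_mono nhdsWithin_le_nhds
  filter_upwards [hne, self_mem_nhdsWithin] with s hs hsU
  rw [heq hsU, mul_div_cancel_left₀ _ hs]

end ZetaQuotient

/-! ### Boundary values for Borel–Jacquet data (unitary normalisation) -/

section BorelJacquet

variable {n : ℕ} {F : Type} [Field F] [NumberField F]

-- Mathlib idiom (Mathlib/Algebra/Lie/OfAssociative.lean); needed to mention Borel–Jacquet data
attribute [local instance 100] LieRing.ofAssociativeRing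

/-- **Boundary values on `Re s = 1` of the partial standard `L`-function of a cuspidal Borel–Jacquet
datum on `GL_n`, `n ≥ 2`.** For `B` cuspidal on `GL_n(𝔸_F)` in the Borel–Jacquet model there is a
finite `S₀` such that for every finite `S ⊇ S₀`, every UNITARY Satake family `β` of `B` off `S`
(`|det β_w| = 1`) and every `s₀` with `Re s₀ = 1`, `L^S(s, β)` has a finite limit as `s → s₀`,
`Re s > 1`: normalise `β_w = q_w^{s₁} α_w` with `α` an honest family of a cuspidal `Π ≤ L²_cusp`
(`CuspidalAutomorphicRepData.exists_satake_eq_cpow_mul_L2_of_le_formsOfL2` on the discharged dictionary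
leaves), `Re s₁ = 0` by unitarity, `L^S(s, β) = L^S(s - s₁, α)` (shift against the family `{1}`), and
apply `exists_tendsto_partialStandardL_of_two_le` at `s₀ - s₁`. This is the finite part of
Arthur–Clozel's (2.2) at `GL_n × GL_1` (the non-vanishing, Jacquet–Shalika 1976, is not needed here).
[cite: GodementJacquet1972, Thm. 13.8] [cite: ArthurClozelAMS120, Ch. 3 §2 (2.2)] -/
theorem exists_tendsto_partialStandardL_bj (hn : 2 ≤ n) (hF : isCompact_glFiniteIntegralLevel n F)
    (B : CuspidalAutomorphicRepData n F hF) :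
    ∃ S₀ : Set (HeightOneSpectrum (𝓞 F)), S₀.Finite ∧
      ∀ {S : Set (HeightOneSpectrum (𝓞 F))} (_hS : S.Finite) (_hS₀ : S₀ ⊆ S) {β : SatakeFamily F}
        (_hβ : ∀ w ∉ S, B.1.HasSatakeParamAt w (β w)) (_hu : ∀ w ∉ S, ‖(β w).prod‖ = 1)
        {s₀ : ℂ} (_hs₀ : s₀.re = 1),
        ∃ c : ℂ, Tendsto (partialStandardL S β) (𝓝[{s : ℂ | 1 < s.re}] s₀) (𝓝 c) := by
  haveI : NeZero n := ⟨by omega⟩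
  haveI := infinite_heightOneSpectrum F
  obtain ⟨μ, hμ⟩ := AdelicGroupData.exists_isAutomorphicMeasure_gl_holds n F
  haveI := hμ
  obtain ⟨B₀, h0W', h0B⟩ := CuspidalAutomorphicRepData.exists_clean_hasSatakeParamAt_of_sSup_irreducible
    AutomorphicRepsGL.stable_cuspidal_eq_sSup_irreducible_holds B
  obtain ⟨s₁, P, S₁, αP, hS₁, hαP, hiff⟩ :=
    CuspidalAutomorphicRepData.exists_satake_eq_cpow_mul_L2_of_le_formsOfL2 (μm := μ)
      AutomorphicRepsGL.exists_le_formsOfL2_of_W'_eq_bot_holds B B₀ h0W' h0B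
  obtain ⟨S₂, hS₂⟩ := exists_tendsto_partialStandardL_of_two_le hn P
  refine ⟨S₁ ∪ ↑S₂, hS₁.union S₂.finite_toSet, ?_⟩
  intro S hS hS₀ β hβ hu s₀ hs₀
  have hS₁S : S₁ ⊆ S := Set.subset_union_left.trans hS₀
  have hβe := eq_map_cpow_mul_of_hasSatakeParamAt hS₁S hiff hβ
  obtain ⟨w₀, hw₀⟩ := hS.infinite_compl.nonempty
  have hs₁ : s₁.re = 0 :=
    re_eq_zero_of_norm_prod_eq_one_of_shift (hαP.mono hS₁S) (by omega) hw₀ (hβe w₀ hw₀) (hu w₀ hw₀)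
  obtain ⟨T, rfl⟩ : ∃ T : Finset (HeightOneSpectrum (𝓞 F)), (↑T : Set (HeightOneSpectrum (𝓞 F))) = S :=
    ⟨hS.toFinset, hS.coe_toFinset⟩
  have hS₂T : S₂ ⊆ T := fun v hv => Finset.mem_coe.1 (hS₀ (Or.inr (Finset.mem_coe.2 hv)))
  obtain ⟨c, hc⟩ := hS₂ T hS₂T (hαP.mono hS₁S) (s₀ - s₁)
  refine ⟨c, ?_⟩
  rw [partialStandardL_eq_partialPairL_one] at hc ⊢
  have h1 : ∀ w ∉ (↑T : Set (HeightOneSpectrum (𝓞 F))), (fun _ : HeightOneSpectrum (𝓞 F) => ({1} : Multiset ℂ)) w =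
      ((fun _ : HeightOneSpectrum (𝓞 F) => ({1} : Multiset ℂ)) w).map (((w.residueCard : ℂ) ^ (0 : ℂ)) * ·) :=
    fun w _ => by simp
  have hz : (s₁ + 0).re = 0 := by rw [add_zero, hs₁]
  refine tendsto_partialPairL_of_shift' hβe h1 hz ?_
  rwa [add_zero]

end BorelJacquet

/-! ### Two small companions: Hecke–Landau for a finite-order `ε`, and a factor identity -/

section GLOne

variable {F : Type} [Field F] [NumberField F]

/-- **`L^S(s, ε)` is finite at `s = 1` for the quadratic character `ε ≠ 1`** (Hecke–Landau on the line,
`exists_ne_zero_tendsto_partialHeckeL_of_re_eq_one`: a finite-order Hecke character is unitary and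
trivial on `A_G`), in the pair spelling `L^S(s, {ε(ϖ_w)} × {1})` of `partialPairL` (the shape consumed by
Rankin–Selberg factorisations such as `adjoint_dihedral_core`). [cite: Iwasawa2019, Ch. 4 §4.2 Prop. 4.4] -/
theorem exists_tendsto_partialPairL_singleton_one (ε : HeckeCharacter F) (hfin : ε.IsFiniteOrder)
    (hε1 : ε ≠ 1) {S : Set (HeightOneSpectrum (𝓞 F))} (hS : S.Finite) (hur : ∀ v ∉ S, ε.IsUnramifiedAt v) :
    ∃ c : ℂ, Tendsto (partialPairL S (fun w => {ε.valueAtUniformizer w}) fun _ => {1})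
      (𝓝[{s : ℂ | 1 < s.re}] 1) (𝓝 c) := by
  obtain ⟨c, -, hc⟩ := exists_ne_zero_tendsto_partialHeckeL_of_re_eq_one ε hfin.isUnitary
    (fun t => GaloisRepresentations.HeckeCharacter.map_posRealIdele_of_isFiniteOrder hfin t) hε1 hS hur
    Complex.one_re
  refine ⟨c, ?_⟩
  convert hc using 1
  funext s
  unfold partialPairL
  refine tprod_congr fun v => ?_
  simp only [satakePairPolynomial_eq_eulerPolynomial, satakeTensor_singleton_right, Multiset.map_singleton,
    eval_eulerPolynomial, Multiset.prod_singleton, one_mul]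

/-- **Folding a `GL_1`-twist into the `GL_1` slot**: `det(1 - (e t) ⊗ 1 · T) = det(1 - t ⊗ e · T)`
(the statement of `satakePairPolynomial_map_mul_one` of `BockleHuiIrreducibleGL3NoContragredientProofs`,
re-derived to keep the imports small). [folklore] -/
theorem satakePairPolynomial_map_mul_singleton_one (α : Multiset ℂ) (e : ℂ) :
    satakePairPolynomial (α.map (e * ·)) {1} = satakePairPolynomial α {e} := by
  rw [satakePairPolynomial_eq_eulerPolynomial, satakePairPolynomial_eq_eulerPolynomial,
    satakeTensor_singleton_right, satakeTensor_singleton_right, Multiset.map_map]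
  congr 1
  exact Multiset.map_congr rfl fun a _ => by simp

end GLOne

end Literature.NumberTheory.Automorphic

end
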